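import Summits.QuantumFields.YangMills.Theorems.FluctuationComparisonRegPrIntLS2BetaTreeGaugeChartLocal
import Summits.QuantumFields.YangMills.Theorems.FluctuationComparisonRegPrIntLS2BetaSignedCombCount
import Literature.MathematicalPhysics.QuantumFieldTheory.Balaban1983to89.T3OrbitAverage
import Literature.MathematicalPhysics.QuantumFieldTheory.Balaban1983to89.FieldMeasureExpChartChangeOfVariables
import Literature.MathematicalPhysics.QuantumFieldTheory.Balaban1983to89.HaarExponentialChartMeasure
import HarnessLib

/-!
# Route `FluctuationComparisonRegPrIntL` (stmt-QuantumFields-20520), LINE g18-1 S2β LAPLACE — (C3β″) TUBULAR HAAR COORDINATES, LOCAL EDITION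
# (EXPORT (F1)(F2)(F3) + the free-bond FRAME `eV` as a datum + (F4a) the BONDWISE FORMULA of the transversal + (F4b′) the density through `det jac`)

Cell `ym3-torus` (HUMAN RULING D-0037 — YM₃ on T³ is ladder rung R3, not the Clay problem), width seat `ym3-torus-px21` g11; count-neutral helper
(`--kind proof --supports stmt-QuantumFields-20520 --as helper`).  Theorems only: 0 `def`, 0 `instance`, 0 `notation`, 0 `sorry`.

WHY.  w5-20520 g14's common-tube reading of FOUR-POINT-DECAY re-bases the Laplace instantiation at a SHIFTED point `y₁` of the transversal of ONE corner's
tube (their (CT) door `…S2BetaLaplaceInstShift.laplaceLimit_of_charts_tendsto_shift`); its binders are the tube rows IN PRODUCT FORM — `IsOpen UZ`, `IsOpen UV`,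
`InjOn Θ' (UZ ×ˢ UV)`, `ContinuousOn jZ UZ`, `ContinuousOn jV UV`, nonnegativity, the chart identity with density `ofReal (jZ w.1 * jV w.2)`, `0 < ρ`,
`closedBall 0 ρ ⊆ UZ` — plus openness of `Θ'` at `(0, y₁)`.  DET-REP's (LOC)∕(JAC) hands need two LOCALITY facts on top (w5-20520 g14 21:29:54Z): (F4a) `σ y b = U₀ b · (T(b₊)⁻¹ · Θ((eV y)_b) · T(b₊))` with
`T = combTransporter k U₀` for every bond off comb ∪ pivots — `σ y b` depends on `y` only through the `b`-component of the frame coordinate `eV y ∈ 𝔰𝔲(2)^{free}`,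
so `Hess (A ∘ σ)` is plaquette-local in these coordinates — and (F4b′) `jV y = σ₀ · |det jac_{𝔰𝔲(2)^{free}}(eV y)|`, `σ₀ > 0` (block-diagonality of the
product-algebra `jac` is the (JAC) hand's).  This file is the lattice instance of the generic local chart
✓`…TreeGaugeChartLocal.exists_tubularChart_of_treeGauge_local` (same virtual-site construction and same proof as ✓`…TubularChartActFactorised`, p745521):
`exists_tubularHaarChart_act_local` = the transversal letter's rows (smooth `σ`, (A0) `σ y = U₀` on comb ∪ pivots, (A1) constant comb transporter,
(A2) quadratic departure, residual group chart onto a neighbourhood of `1`, injectivity, origin openness) with the window, the density and the openness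
EXPORTED AS (F1) `UZ ×ˢ UV` (`closedBall 0 ρ₀ ⊆ UZ`), (F2) `jZ z · jV y` (continuous, `≥ 0`, positive at `0`), (F3) `∀ p ∈ UZ ×ˢ UV, ∀ s ∈ 𝓝 p, Θ' '' s ∈ 𝓝 (Θ' p)`,
the FRAME `eV : ℝ^{dV} ≃L 𝔰𝔲(2)^{free bonds}` (the product chart's Lie algebra; components via lit `lieApply`), (F4a) and (F4b′).
The docked edition is `…TubularChartDockLocal`.
HONEST: a chart-side helper; nothing of LIMIT∕(CT)∕FOUR-POINT-DECAY∕LAPLACE∕S2β∕crux 20520 is proved here; rung R3 — NOT d = 4, NOT infinite volume, NOT a mass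
gap, NOT Clay.
-/

noncomputable section

open MeasureTheory MeasureTheory.Measure Filter Topology Set Function
open scoped ENNReal Matrix.Norms.L2Operator
open Literature.MathematicalPhysics.QuantumFieldTheory.Balaban1983to89
open Literature.MathematicalPhysics.QuantumFieldTheory.Balaban1983to89.B12GaugeOrbits021 (IsResidual)
open Literature.MathematicalPhysics.QuantumFieldTheory.Balaban1983to89.HaarExponentialChart
open Literature.MathematicalPhysics.QuantumFieldTheory.Balaban1983to89.LogChartProduct
open Literature.MathematicalPhysics.QuantumFieldTheory.Balaban1983to89.T4RootedResidualGauge (rootOf rootOf_embIter)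
open Literature.MathematicalPhysics.QuantumFieldTheory.Balaban1983to89.B15DeterminingSets (embIter)
open Literature.MathematicalPhysics.QuantumFieldTheory.Balaban1983to89.B14.Eq22Determines (blockIter)
open Literature.MathematicalPhysics.QuantumFieldTheory.Balaban1983to89.B15Eq177GaugeInvariance (blockIter_embIter)
open scoped Literature.MathematicalPhysics.QuantumFieldTheory.Balaban1983to89.T3OrbitAverage
open Summit.QuantumFields.YangMills.Theorems.FluctuationComparisonRegPrIntLWregChain (iterCentralBond iterCentralBond_injective)
open Summit.QuantumFields.YangMills.Theorems.FluctuationComparisonRegPrIntLS2BetaTreeGaugeChartLocal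
open Literature.MathematicalPhysics.QuantumFieldTheory.Balaban1983to89.B13HaarSigmaJacobian (jac)
open Summit.QuantumFields.YangMills.Theorems.FluctuationComparisonRegPrIntLS2BetaSignedComb
open Summit.QuantumFields.YangMills.Theorems.FluctuationComparisonRegPrIntLS2BetaSignedCombKill
open Summit.QuantumFields.YangMills.Theorems.FluctuationComparisonRegPrIntLS2BetaSignedCombCount

namespace Summit.QuantumFields.YangMills.Theorems.FluctuationComparisonRegPrIntLS2BetaTubularChartActLocal

set_option maxHeartbeats 400000 in
/-- ★★★ **(C3β″) TUBULAR HAAR COORDINATES AROUND AN ORBIT OF `K₀ × SU(2)^{pivots}`, LOCAL EDITION** (letter v2.1 with the window, density and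
openness exported in product form, the free-bond frame `eV` exported, (F4a) the bondwise formula of `σ` and (F4b′) `jV = σ₀·|det jac(eV ·)|`).  Setting of w5-20520 g13's (β″): the fine fields `X = SU(2)^{bonds}` with product Haar `dU`; the group
`Kg = K₀ × SU(2)^{PBond P k}` (`K₀` = level-`k` residual = root-trivial transformations, `k := K − J`) acting by
`ACT (w, hp) U := extend (iterCentralBond k) (c ↦ hp c · U (iterCentralBond k c)) (w • U)`.  For every base point `U₀`: Euclidean models of dimensions `dZ`, `dV`,
a group chart `e = (e_res, e_piv)` onto a neighbourhood of `1` among the residual pairs, a smooth transversal `σ` through `U₀` with (A0)(A1)(A2), OPEN WINDOWS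
`UZ ∋ 0`, `UV ∋ 0` with `closedBall 0 ρ₀ ⊆ UZ` (F1), the tube map `Θ'(z, y) = ACT (e z) (σ y)` injective on `UZ ×ˢ UV`, open at the origin AND AT EVERY POINT OF
`UZ ×ˢ UV` (F3), continuous densities `jZ, jV ≥ 0` positive at `0` (F2), and the chart identity `dU|_{Θ'(UZ × UV)} = Θ'_*((jZ ⊗ jV · dz ⊗ dy)|_{UZ × UV})`.
[cite: Helgason2000, Ch. I §1 Thm 1.14 (13) p. 96; Balaban1985Averaging, (8), (10) p.18; Balaban1985Variational, Thm 1 (8)-(10) p.279] -/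
theorem exists_tubularHaarChart_act_local (P : Params) {k : ℕ} (hk : k ≤ P.m + P.K)
    [DecidablePred (· ∈ (combSet k : Set (PBond P 0)) ∪ Set.range (iterCentralBond (P := P) k))] (dZ dV : ℕ)
    (hdZ : dZ = Module.finrank ℝ (specialUnitaryLogChart (Fin 2)).lie *
      ((Fintype.card (Site P 0) - Fintype.card (Site P k)) + Fintype.card (PBond P k)))
    (hdV : dV = Module.finrank ℝ (specialUnitaryLogChart (Fin 2)).lie * (Fintype.card (PBond P 0) - Fintype.card (PBond P k)) -
      Module.finrank ℝ (specialUnitaryLogChart (Fin 2)).lie * (Fintype.card (Site P 0) - Fintype.card (Site P k)))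
    (U₀ : GaugeField P 0 (Matrix.specialUnitaryGroup (Fin 2) ℂ)) :
    ∃ (e : EuclideanSpace ℝ (Fin dZ) →
          (Site P 0 → Matrix.specialUnitaryGroup (Fin 2) ℂ) × (PBond P k → Matrix.specialUnitaryGroup (Fin 2) ℂ))
      (σ : EuclideanSpace ℝ (Fin dV) → GaugeField P 0 (Matrix.specialUnitaryGroup (Fin 2) ℂ))
      (eV : EuclideanSpace ℝ (Fin dV) ≃L[ℝ] (piLogChart (specialUnitaryLogChart (Fin 2)) {b : PBond P 0 // b ∉ (combSet k : Set (PBond P 0)) ∪ Set.range (iterCentralBond (P := P) k)}).lie)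
      (UZ : Set (EuclideanSpace ℝ (Fin dZ))) (UV : Set (EuclideanSpace ℝ (Fin dV)))
      (jZ : EuclideanSpace ℝ (Fin dZ) → ℝ) (jV : EuclideanSpace ℝ (Fin dV) → ℝ) (ρ₀ : ℝ),
      Continuous e ∧ e 0 = 1 ∧ (∀ z, IsResidual k (e z).1) ∧
      (∀ s ∈ 𝓝 (0 : EuclideanSpace ℝ (Fin dZ)),
        ∃ t ∈ 𝓝 ((1 : Site P 0 → Matrix.specialUnitaryGroup (Fin 2) ℂ), (1 : PBond P k → Matrix.specialUnitaryGroup (Fin 2) ℂ)),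
          ∀ w ∈ t, IsResidual k w.1 → w ∈ e '' s) ∧
      Continuous σ ∧ σ 0 = U₀ ∧
      ContDiff ℝ ⊤ (fun y : EuclideanSpace ℝ (Fin dV) => fun b : PBond P 0 =>
        ((σ y b : Matrix.specialUnitaryGroup (Fin 2) ℂ) : Matrix (Fin 2) (Fin 2) ℂ)) ∧
      (∀ y, ∀ b ∈ (combSet k : Set (PBond P 0)) ∪ Set.range (iterCentralBond (P := P) k), σ y b = U₀ b) ∧
      (∀ y, combTransporter k (σ y) = combTransporter k U₀) ∧
      (∀ y (b : PBond P 0) (hb : b ∉ (combSet k : Set (PBond P 0)) ∪ Set.range (iterCentralBond (P := P) k)),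
        σ y b = U₀ b * ((combTransporter k U₀ b.tgt)⁻¹ *
          (isChartRep_specialUnitaryGroup (n := Fin 2)).expChart
            (lieApply (specialUnitaryLogChart (Fin 2)) {b : PBond P 0 // b ∉ (combSet k : Set (PBond P 0)) ∪ Set.range (iterCentralBond (P := P) k)} (eV y) ⟨b, hb⟩) *
          combTransporter k U₀ b.tgt)) ∧
      (∃ c : ℝ, 0 < c ∧ ∀ᶠ y in 𝓝 (0 : EuclideanSpace ℝ (Fin dV)),
        c * ‖y‖ ^ 2 ≤ ∑ b : PBond P 0, dist1 (σ y b * (U₀ b)⁻¹) ^ 2) ∧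
      IsOpen UZ ∧ IsOpen UV ∧ (0 : EuclideanSpace ℝ (Fin dZ)) ∈ UZ ∧ (0 : EuclideanSpace ℝ (Fin dV)) ∈ UV ∧
      0 < ρ₀ ∧ Metric.closedBall (0 : EuclideanSpace ℝ (Fin dZ)) ρ₀ ⊆ UZ ∧
      InjOn (fun p : EuclideanSpace ℝ (Fin dZ) × EuclideanSpace ℝ (Fin dV) =>
            Function.extend (iterCentralBond (P := P) k) (fun c => (e p.1).2 c * σ p.2 (iterCentralBond (P := P) k c))
              (GaugeField.gaugeAct (e p.1).1 (σ p.2))) (UZ ×ˢ UV) ∧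
      (∀ s ∈ 𝓝 ((0 : EuclideanSpace ℝ (Fin dZ)), (0 : EuclideanSpace ℝ (Fin dV))),
          (fun p : EuclideanSpace ℝ (Fin dZ) × EuclideanSpace ℝ (Fin dV) =>
            Function.extend (iterCentralBond (P := P) k) (fun c => (e p.1).2 c * σ p.2 (iterCentralBond (P := P) k c))
              (GaugeField.gaugeAct (e p.1).1 (σ p.2))) '' s ∈ 𝓝 U₀) ∧
      (∀ p ∈ UZ ×ˢ UV, ∀ s ∈ 𝓝 p,
          (fun p : EuclideanSpace ℝ (Fin dZ) × EuclideanSpace ℝ (Fin dV) =>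
            Function.extend (iterCentralBond (P := P) k) (fun c => (e p.1).2 c * σ p.2 (iterCentralBond (P := P) k c))
              (GaugeField.gaugeAct (e p.1).1 (σ p.2))) '' s ∈
            𝓝 ((fun p : EuclideanSpace ℝ (Fin dZ) × EuclideanSpace ℝ (Fin dV) =>
            Function.extend (iterCentralBond (P := P) k) (fun c => (e p.1).2 c * σ p.2 (iterCentralBond (P := P) k c))
              (GaugeField.gaugeAct (e p.1).1 (σ p.2))) p)) ∧
      Continuous jZ ∧ Continuous jV ∧ (∀ z, 0 ≤ jZ z) ∧ (∀ y, 0 ≤ jV y) ∧ 0 < jZ 0 ∧ 0 < jV 0 ∧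
      (∃ σ₀ : ℝ, 0 < σ₀ ∧ ∀ y, jV y = σ₀ * |LinearMap.det
        (jac (lie_adStable_pi (specialUnitaryLogChart (Fin 2)) {b : PBond P 0 // b ∉ (combSet k : Set (PBond P 0)) ∪ Set.range (iterCentralBond (P := P) k)}
            (lie_adStable_specialUnitaryGroup (n := Fin 2))) (eV y) :
          (piLogChart (specialUnitaryLogChart (Fin 2)) {b : PBond P 0 // b ∉ (combSet k : Set (PBond P 0)) ∪ Set.range (iterCentralBond (P := P) k)}).lie →ₗ[ℝ]
          (piLogChart (specialUnitaryLogChart (Fin 2)) {b : PBond P 0 // b ∉ (combSet k : Set (PBond P 0)) ∪ Set.range (iterCentralBond (P := P) k)}).lie)|) ∧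
      (fieldMeasure P 0 (Matrix.specialUnitaryGroup (Fin 2) ℂ)).restrict
          ((fun p : EuclideanSpace ℝ (Fin dZ) × EuclideanSpace ℝ (Fin dV) =>
            Function.extend (iterCentralBond (P := P) k) (fun c => (e p.1).2 c * σ p.2 (iterCentralBond (P := P) k c))
              (GaugeField.gaugeAct (e p.1).1 (σ p.2))) '' (UZ ×ˢ UV)) =
        ((((volume : Measure (EuclideanSpace ℝ (Fin dZ))).prod (volume : Measure (EuclideanSpace ℝ (Fin dV)))).restrict (UZ ×ˢ UV)).withDensity
            (fun w => ENNReal.ofReal (jZ w.1 * jV w.2))).map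
          (fun p : EuclideanSpace ℝ (Fin dZ) × EuclideanSpace ℝ (Fin dV) =>
            Function.extend (iterCentralBond (P := P) k) (fun c => (e p.1).2 c * σ p.2 (iterCentralBond (P := P) k c))
              (GaugeField.gaugeAct (e p.1).1 (σ p.2))) := by
  -- the group, its chart and its Haar probability measure
  haveI : FiniteDimensional ℝ (Matrix (Fin 2) (Fin 2) ℂ) := FiniteDimensional.complexToReal _
  haveI : (HaarData.haar : Measure (Matrix.specialUnitaryGroup (Fin 2) ℂ)).IsHaarMeasure :=
    FieldMeasureExpChartChangeOfVariables.isHaarMeasure_haar_specialUnitaryGroup (N := 2)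
  have hch := isChartRep_specialUnitaryGroup (n := Fin 2)
  have hlie := lie_adStable_specialUnitaryGroup (n := Fin 2)
  -- the pivots
  have hιinj : Injective (iterCentralBond (P := P) k) := iterCentralBond_injective hk
  have hembinj : Injective (embIter k : Site P k → Site P 0) := Function.LeftInverse.injective (blockIter_embIter k hk)
  -- the extended lattice: one virtual site `inr c` per pivot
  set s' : PBond P 0 → Site P 0 ⊕ PBond P k :=
    Function.extend (iterCentralBond (P := P) k) (fun c => Sum.inr c) (fun b => Sum.inl b.src) with hs'
  set t' : PBond P 0 → Site P 0 ⊕ PBond P k :=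
    Function.extend (iterCentralBond (P := P) k) (fun c => Sum.inl (rootOf k (iterCentralBond (P := P) k c).tgt))
      (fun b => Sum.inl b.tgt) with ht'
  set R' : Set (Site P 0 ⊕ PBond P k) := Set.range (fun y : Site P k => (Sum.inl (embIter k y) : Site P 0 ⊕ PBond P k)) with hR'
  -- the killed bonds: comb ∪ pivots (a `let`, NOT a `set`: the statement's `DecidablePred` binder must stay the one instance of record)
  let F' : Set (PBond P 0) := (combSet k : Set (PBond P 0)) ∪ Set.range (iterCentralBond (P := P) k)
  have hF' : F' = (combSet k : Set (PBond P 0)) ∪ Set.range (iterCentralBond (P := P) k) := rfl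
  letI : DecidablePred (· ∈ F') := ‹DecidablePred (· ∈ (combSet k : Set (PBond P 0)) ∪ Set.range (iterCentralBond (P := P) k))›
  set g' : (PBond P 0 → Matrix.specialUnitaryGroup (Fin 2) ℂ) → (Site P 0 ⊕ PBond P k → Matrix.specialUnitaryGroup (Fin 2) ℂ) :=
    fun V => Sum.elim (fun x => combTransporter k V x) (fun c => (V (iterCentralBond (P := P) k c))⁻¹) with hg'
  have hs'piv : ∀ c, s' (iterCentralBond (P := P) k c) = Sum.inr c := fun c => hιinj.extend_apply _ _ c
  have ht'piv : ∀ c, t' (iterCentralBond (P := P) k c) = Sum.inl (rootOf k (iterCentralBond (P := P) k c).tgt) :=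
    fun c => hιinj.extend_apply _ _ c
  have hs'off : ∀ b, b ∉ Set.range (iterCentralBond (P := P) k) → s' b = Sum.inl b.src :=
    fun b hb => Function.extend_apply' _ _ b hb
  have ht'off : ∀ b, b ∉ Set.range (iterCentralBond (P := P) k) → t' b = Sum.inl b.tgt :=
    fun b hb => Function.extend_apply' _ _ b hb
  have hrootR : ∀ x : Site P 0, (Sum.inl (rootOf k x) : Site P 0 ⊕ PBond P k) ∈ R' := fun x => ⟨blockIter k x, rfl⟩
  have hcombOff : ∀ b ∈ (combSet k : Set (PBond P 0)), b ∉ Set.range (iterCentralBond (P := P) k) :=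
    fun b hb ⟨c, hc⟩ => iterCentralBond_not_mem_combSet hk c (hc ▸ hb)
  -- Borel structures and frames
  letI : MeasurableSpace (piLogChart (specialUnitaryLogChart (Fin 2)) {x : Site P 0 ⊕ PBond P k // x ∉ R'}).lie := borel _
  haveI : BorelSpace (piLogChart (specialUnitaryLogChart (Fin 2)) {x : Site P 0 ⊕ PBond P k // x ∉ R'}).lie := ⟨rfl⟩
  letI : MeasurableSpace (piLogChart (specialUnitaryLogChart (Fin 2)) {b : PBond P 0 // b ∉ F'}).lie := borel _
  haveI : BorelSpace (piLogChart (specialUnitaryLogChart (Fin 2)) {b : PBond P 0 // b ∉ F'}).lie := ⟨rfl⟩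
  haveI := finiteDimensional_piLogChart_lie (specialUnitaryLogChart (Fin 2)) {x : Site P 0 ⊕ PBond P k // x ∉ R'}
  haveI := finiteDimensional_piLogChart_lie (specialUnitaryLogChart (Fin 2)) {b : PBond P 0 // b ∉ F'}
  have hfr : ∀ (B : Type) [Fintype B], Module.finrank ℝ (piLogChart (specialUnitaryLogChart (Fin 2)) B).lie =
      Fintype.card B * Module.finrank ℝ (specialUnitaryLogChart (Fin 2)).lie := by
    intro B _
    rw [LinearEquiv.finrank_eq (lieEquivPi (specialUnitaryLogChart (Fin 2)) B), Module.finrank_pi_fintype, Finset.sum_const,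
      Finset.card_univ, smul_eq_mul]
  -- cardinalities
  have hcardR : Fintype.card {x : Site P 0 ⊕ PBond P k // x ∉ R'} =
      (Fintype.card (Site P 0) - Fintype.card (Site P k)) + Fintype.card (PBond P k) := by
    have hinj : Injective (fun y : Site P k => (Sum.inl (embIter k y) : Site P 0 ⊕ PBond P k)) :=
      Sum.inl_injective.comp hembinj
    have h1 : Nat.card {x : Site P 0 ⊕ PBond P k // x ∉ R'} = Nat.card (Site P 0 ⊕ PBond P k) - R'.ncard := by
      rw [← Set.ncard_compl R', ← Nat.card_coe_set_eq]; rfl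
    have h2 : R'.ncard = Fintype.card (Site P k) := by
      rw [← Nat.card_coe_set_eq, hR', Nat.card_range_of_injective hinj, Nat.card_eq_fintype_card]
    have hle : Fintype.card (Site P k) ≤ Fintype.card (Site P 0) := Fintype.card_le_of_injective _ hembinj
    rw [← Nat.card_eq_fintype_card, h1, h2, Nat.card_sum, Nat.card_eq_fintype_card, Nat.card_eq_fintype_card]
    omega
  have hcardF : Fintype.card {b : PBond P 0 // b ∉ F'} =
      (Fintype.card (PBond P 0) - Fintype.card (PBond P k)) - (Fintype.card (Site P 0) - Fintype.card (Site P k)) := by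
    have h1 : Nat.card {b : PBond P 0 // b ∉ F'} = Nat.card (PBond P 0) - F'.ncard := by
      rw [← Set.ncard_compl F', ← Nat.card_coe_set_eq]; rfl
    have h2 : F'.ncard = (Fintype.card (Site P 0) - Fintype.card (Site P k)) + Fintype.card (PBond P k) := by
      rw [hF', Set.ncard_union_eq (Set.disjoint_left.2 fun b hb hb' => hcombOff b hb hb'), ← Nat.card_coe_set_eq,
        nat_card_combSet hk, ← Nat.card_coe_set_eq, Nat.card_range_of_injective hιinj, Nat.card_eq_fintype_card]
    rw [← Nat.card_eq_fintype_card, h1, h2, Nat.card_eq_fintype_card]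
    omega
  obtain ⟨eZ⟩ : Nonempty (EuclideanSpace ℝ (Fin dZ) ≃L[ℝ]
      (piLogChart (specialUnitaryLogChart (Fin 2)) {x : Site P 0 ⊕ PBond P k // x ∉ R'}).lie) :=
    ⟨ContinuousLinearEquiv.ofFinrankEq (by rw [finrank_euclideanSpace_fin, hfr, hcardR, hdZ, mul_comm])⟩
  obtain ⟨eV⟩ : Nonempty (EuclideanSpace ℝ (Fin dV) ≃L[ℝ] (piLogChart (specialUnitaryLogChart (Fin 2)) {b : PBond P 0 // b ∉ F'}).lie) :=
    ⟨ContinuousLinearEquiv.ofFinrankEq (by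
      rw [finrank_euclideanSpace_fin, hfr, hcardF, hdV, Nat.sub_mul, mul_comm (Fintype.card (PBond P 0) - _),
        mul_comm (Fintype.card (Site P 0) - _)])⟩
  -- the six tree-gauge axioms
  have hgc : Continuous g' := by
    refine continuous_pi fun i => ?_
    rcases i with x | c
    · exact (continuous_apply x).comp (continuous_combTransporter (P := P) (G := Matrix.specialUnitaryGroup (Fin 2) ℂ) k)
    · exact (continuous_apply (iterCentralBond (P := P) k c)).inv
  have hgR : ∀ V, ∀ r ∈ R', g' V r = 1 := by
    rintro V r ⟨y, rfl⟩
    exact combTransporter_embIter hk V y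
  have hcov : ∀ (a : Site P 0 ⊕ PBond P k → Matrix.specialUnitaryGroup (Fin 2) ℂ), (∀ r ∈ R', a r = 1) →
      ∀ (V : PBond P 0 → Matrix.specialUnitaryGroup (Fin 2) ℂ) (x : Site P 0 ⊕ PBond P k),
        g' (fun b => a (s' b) * V b * (a (t' b))⁻¹) x = g' V x * (a x)⁻¹ := by
    intro a ha V x
    have hroot : ∀ y : Site P k, a (Sum.inl (embIter k y)) = 1 := fun y => ha _ ⟨y, rfl⟩
    rcases x with x | c
    · show combTransporter k (fun b => a (s' b) * V b * (a (t' b))⁻¹) x = combTransporter k V x * (a (Sum.inl x))⁻¹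
      have hE : ∀ b ∈ (combSet k : Set (PBond P 0)), (fun b => a (s' b) * V b * (a (t' b))⁻¹) b =
          GaugeField.gaugeAct (fun y => a (Sum.inl y)) V b := by
        intro b hb
        simp only [GaugeField.gaugeAct, hs'off b (hcombOff b hb), ht'off b (hcombOff b hb)]
      rw [congrFun (combTransporter_congr hk hE) x, combTransporter_gaugeAct_of_rootTrivial k hroot V x]
    · show (a (s' (iterCentralBond (P := P) k c)) * V (iterCentralBond (P := P) k c) * (a (t' (iterCentralBond (P := P) k c)))⁻¹)⁻¹ =
        (V (iterCentralBond (P := P) k c))⁻¹ * (a (Sum.inr c))⁻¹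
      rw [hs'piv, ht'piv, ha _ (hrootR _), inv_one, mul_one, mul_inv_rev]
  have hkill : ∀ V, ∀ b ∈ F', g' V (s' b) * V b * (g' V (t' b))⁻¹ = 1 := by
    intro V b hb
    rcases hb with hb | ⟨c, rfl⟩
    · rw [hs'off b (hcombOff b hb), ht'off b (hcombOff b hb)]
      exact combTransporter_kill hk V hb
    · rw [hs'piv, ht'piv]
      show (V (iterCentralBond (P := P) k c))⁻¹ * V (iterCentralBond (P := P) k c) *
        (combTransporter k V (rootOf k (iterCentralBond (P := P) k c).tgt))⁻¹ = 1
      rw [inv_mul_cancel, one_mul, show rootOf k (iterCentralBond (P := P) k c).tgt =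
        embIter k (blockIter k (iterCentralBond (P := P) k c).tgt) from rfl, combTransporter_embIter hk, inv_one]
  have hloc : ∀ V V' : PBond P 0 → Matrix.specialUnitaryGroup (Fin 2) ℂ, (∀ b ∈ F', V b = V' b) → g' V = g' V' := by
    intro V V' hVV
    funext i
    rcases i with x | c
    · exact congrFun (combTransporter_congr hk fun b hb => hVV b (Or.inl hb)) x
    · show (V (iterCentralBond (P := P) k c))⁻¹ = (V' (iterCentralBond (P := P) k c))⁻¹
      rw [hVV _ (Or.inr ⟨c, rfl⟩)]
  have hg1 : g' (fun _ => 1) = fun _ => 1 := by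
    funext i
    rcases i with x | c
    · show combTransporter k (1 : GaugeField P 0 (Matrix.specialUnitaryGroup (Fin 2) ℂ)) x = 1
      rw [combTransporter_one]
    · exact inv_one
  -- THE GENERIC CHART
  obtain ⟨e, σ, UZ, UV, jZ, jV, hec, he0, heR, hsurj, hσc, hσ0, hσs, hσF, hσg, hF4, hσgr, hUZo, hUVo, h0Z, h0V, hinj, hopen, hF3,
      hjZc, hjVc, hjZ0, hjV0, hjZpos, hjVpos, hF4b, hchart⟩ :=
    exists_tubularChart_of_treeGauge_local hch hlie (HaarData.haar : Measure (Matrix.specialUnitaryGroup (Fin 2) ℂ)) s' t' R' F' g'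
      eZ eV hgc hgR hcov hkill hloc hg1 U₀
  -- the action of record IS the generic gauge formula on the extended lattice
  have hkey : ∀ p : EuclideanSpace ℝ (Fin dZ) × EuclideanSpace ℝ (Fin dV),
      Function.extend (iterCentralBond (P := P) k) (fun c => e p.1 (Sum.inr c) * σ p.2 (iterCentralBond (P := P) k c))
        (GaugeField.gaugeAct (fun x => e p.1 (Sum.inl x)) (σ p.2)) = fun b => e p.1 (s' b) * σ p.2 b * (e p.1 (t' b))⁻¹ := by
    intro p
    funext b
    by_cases hb : ∃ c, iterCentralBond (P := P) k c = b
    · obtain ⟨c, rfl⟩ := hb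
      rw [hιinj.extend_apply, hs'piv, ht'piv, heR _ _ (hrootR _), inv_one, mul_one]
    · rw [Function.extend_apply' _ _ b hb, hs'off b hb, ht'off b hb]
      rfl
  have hΘ : (fun p : EuclideanSpace ℝ (Fin dZ) × EuclideanSpace ℝ (Fin dV) =>
      Function.extend (iterCentralBond (P := P) k)
        (fun c => ((fun x : Site P 0 => e p.1 (Sum.inl x)), (fun c : PBond P k => e p.1 (Sum.inr c))).2 c *
          σ p.2 (iterCentralBond (P := P) k c))
        (GaugeField.gaugeAct ((fun x : Site P 0 => e p.1 (Sum.inl x)), (fun c : PBond P k => e p.1 (Sum.inr c))).1 (σ p.2))) =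
      fun p => fun b => e p.1 (s' b) * σ p.2 b * (e p.1 (t' b))⁻¹ := by
    funext p; exact hkey p
  -- a ball in the residual window
  obtain ⟨ε, hε, hball⟩ := Metric.isOpen_iff.1 hUZo _ h0Z
  refine ⟨fun z => ((fun x : Site P 0 => e z (Sum.inl x)), (fun c : PBond P k => e z (Sum.inr c))), σ, eV, UZ, UV, jZ, jV, ε / 2,
    ?_, ?_, ?_, ?_, hσc, hσ0, hσs, hσF, ?_, ?_, ?_, hUZo, hUVo, h0Z, h0V, by linarith, ?_, ?_, ?_, ?_,
    hjZc, hjVc, hjZ0, hjV0, hjZpos, hjVpos, hF4b, ?_⟩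
  · -- `e` continuous
    exact (continuous_pi fun x => (continuous_apply _).comp hec).prodMk (continuous_pi fun c => (continuous_apply _).comp hec)
  · -- `e 0 = 1`
    simp only [he0, Pi.one_apply]; rfl
  · -- residual
    intro z y
    exact heR z _ ⟨y, rfl⟩
  · -- onto a neighbourhood of `(1, 1)` among the residual pairs
    intro sZ hsZ
    obtain ⟨tt, htt, hsub⟩ := hsurj sZ hsZ
    set jn : (Site P 0 → Matrix.specialUnitaryGroup (Fin 2) ℂ) × (PBond P k → Matrix.specialUnitaryGroup (Fin 2) ℂ) →
        (Site P 0 ⊕ PBond P k → Matrix.specialUnitaryGroup (Fin 2) ℂ) := fun w => Sum.elim w.1 w.2 with hjn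
    have hjnc : Continuous jn := by
      refine continuous_pi fun i => ?_
      rcases i with x | c
      · exact (continuous_apply x).comp continuous_fst
      · exact (continuous_apply c).comp continuous_snd
    have hjn1 : jn ((1 : Site P 0 → Matrix.specialUnitaryGroup (Fin 2) ℂ), (1 : PBond P k → Matrix.specialUnitaryGroup (Fin 2) ℂ)) = 1 := by
      funext i; rcases i with x | c <;> rfl
    refine ⟨jn ⁻¹' tt, hjnc.continuousAt.preimage_mem_nhds (by rw [hjn1]; exact htt), ?_⟩
    intro w hw hwres
    have hR : ∀ r ∈ R', jn w r = 1 := by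
      rintro r ⟨y, rfl⟩
      exact hwres y
    obtain ⟨z, hz, hzw⟩ := hsub (jn w) hw hR
    refine ⟨z, hz, ?_⟩
    refine Prod.ext (funext fun x => ?_) (funext fun c => ?_)
    · exact congrFun hzw (Sum.inl x)
    · exact congrFun hzw (Sum.inr c)
  · -- (A1) the comb transporter is constant along the transversal (`inl`-components of the generic (σ-transporter) row)
    intro y
    funext x
    have h1 := congrFun (hσg y) (Sum.inl x)
    simpa only [hg', Sum.elim_inl] using h1
  · -- (F4a) the bondwise formula: off comb ∪ pivots `t' b = inl b₊` and `g' U₀ (inl x) = combTransporter k U₀ x`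
    intro y b hb
    have hb' : b ∉ Set.range (iterCentralBond (P := P) k) := fun h => hb (Or.inr h)
    have h1 := hF4 y b hb
    rw [ht'off b hb'] at h1
    simpa only [hg', Sum.elim_inl] using h1
  · -- (A2) quadratic departure from the base point: the generic (σ-growth) row, the coordinate ratio being a conjugate of `U₀(b)⁻¹ σ y(b)`
    obtain ⟨c, hc, hev⟩ := hσgr
    refine ⟨c, hc, ?_⟩
    filter_upwards [hev] with y hy
    refine hy.trans ?_
    have hT : g' (σ y) = g' U₀ := hσg y
    have hterm : ∀ b : {b // b ∉ F'},
        ‖(Literature.MathematicalPhysics.QuantumLattice.fundamentalRep (Fin 2)) ((g' U₀ (s' b) * U₀ b * (g' U₀ (t' b))⁻¹)⁻¹ * (g' (σ y) (s' b) * σ y b * (g' (σ y) (t' b))⁻¹)) - 1‖ ^ 2 =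
          dist1 (σ y b * (U₀ b)⁻¹) ^ 2 := by
      intro b
      rw [hT]
      show dist1 ((g' U₀ (s' b) * U₀ b * (g' U₀ (t' b))⁻¹)⁻¹ * (g' U₀ (s' b) * σ y b * (g' U₀ (t' b))⁻¹)) ^ 2 = _
      rw [show (g' U₀ (s' b) * U₀ b * (g' U₀ (t' b))⁻¹)⁻¹ * (g' U₀ (s' b) * σ y b * (g' U₀ (t' b))⁻¹) =
          g' U₀ (t' b) * ((U₀ b)⁻¹ * (σ y b * (U₀ b)⁻¹) * (U₀ b)⁻¹⁻¹) * (g' U₀ (t' b))⁻¹ by group,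
        GaugeGroup.dist1_conj, GaugeGroup.dist1_conj]
    calc ∑ b : {b // b ∉ F'},
          ‖(Literature.MathematicalPhysics.QuantumLattice.fundamentalRep (Fin 2)) ((g' U₀ (s' b) * U₀ b * (g' U₀ (t' b))⁻¹)⁻¹ * (g' (σ y) (s' b) * σ y b * (g' (σ y) (t' b))⁻¹)) - 1‖ ^ 2
        = ∑ b : {b // b ∉ F'}, dist1 (σ y b * (U₀ b)⁻¹) ^ 2 := Finset.sum_congr rfl fun b _ => hterm b
      _ = ∑ b ∈ Finset.univ.filter (fun b : PBond P 0 => b ∉ F'), dist1 (σ y b * (U₀ b)⁻¹) ^ 2 :=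
        (Finset.sum_subtype _ (fun b => by simp) (fun b : PBond P 0 => dist1 (σ y b * (U₀ b)⁻¹) ^ 2)).symm
      _ ≤ ∑ b : PBond P 0, dist1 (σ y b * (U₀ b)⁻¹) ^ 2 :=
        Finset.sum_le_sum_of_subset_of_nonneg (Finset.filter_subset _ _) fun _ _ _ => sq_nonneg _
  · -- (F1) the ball `closedBall 0 (ε/2)` lies in `UZ`
    intro z hz
    rw [Metric.mem_closedBall, dist_zero_right] at hz
    apply hball
    rw [Metric.mem_ball, dist_zero_right]
    linarith
  · -- injectivity on the window
    rw [hΘ]; exact hinj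
  · -- openness at the origin
    rw [hΘ]; exact hopen
  · -- (F3) openness at every point of the window
    rw [hΘ]; exact hF3
  · -- THE CHART IDENTITY (`fieldMeasure = ⊗ Haar` is `rfl`)
    rw [hΘ]; exact hchart

end Summit.QuantumFields.YangMills.Theorems.FluctuationComparisonRegPrIntLS2BetaTubularChartActLocal

end
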